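import Literature.AlgebraicGeometry.Pohlmann1968.NondegenerateCMAlgebraTypes
import Literature.AlgebraicGeometry.ComplexMultiplication.SimpleIffPrimitiveCMType
import Literature.AlgebraicGeometry.ComplexMultiplication.ShimuraIsogenyHolds
import Literature.AlgebraicGeometry.Milne1999.CMHodgeHypothesisFromCMTypedProducts
import Literature.FieldTheory.AlgClosed.AutFixedSubfield
import HarnessLib

/-!
# Separating families of CM types = families of PRIMITIVE, pairwise CM-INEQUIVALENT types; on abelian varieties:
# SIMPLE, pairwise NON-ISOGENOUS realisations (Gordon's Def. 7.4 hypothesis ⟺ Kubota separation)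

Companion of `Pohlmann1968/NondegenerateCMAlgebraTypes` (theorems only; no definition, no named fact).  There the
predicate `CMAlgebra.IsSeparatingFamily Φ` — the `Aut(ℂ)`-translates of Deligne's CM type `Σ = ⊔_i {i} × Φ_i` of the
CM algebra `∏_i K_i` separate the points of `⊔_i Hom(K_i, ℂ)` (Kubota's primitivity of `Σ`) — is shown to IMPLY that
every member `Φ_i` is primitive (`IsSeparatingFamily.isPrimitive`) and that no two members are CM-equivalent along an
isomorphism of their fields (`IsSeparatingFamily.eq_of_forall_mem_iff_comp_mem`); its docstring identifies it with the
standing hypothesis «the `A_i` simple and nonisogenous» of Gordon's Definition 7.4 / Theorem 7.5 (Hazama–Murty).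
This file proves the CONVERSE, so that the identification is a theorem:

* §1 `exists_ringEquiv_of_isPrimitive_of_forall_comp_mem_iff` — the Galois lemma behind it: if `Φ ⊆ Hom(K, ℂ)` and
  `Φ' ⊆ Hom(K', ℂ)` are PRIMITIVE (Shimura §8.2 Prop. 26: the right stabiliser of the pattern `g ↦ [g ∘ s ∈ Φ]` is
  exactly `Aut(ℂ/s(K))`) and `s : K → ℂ`, `t : K' → ℂ` have the same pattern (`τ ∘ s ∈ Φ ⟺ τ ∘ t ∈ Φ'` for all
  `τ ∈ Aut(ℂ)`), then `s(K) = t(K')` (an automorphism of `ℂ` fixing `t(K')` fixes the pattern, hence fixes `s` by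
  primitivity; the fixed field of `Aut(ℂ/F)` is `F`, tree `Complex.exists_ringEquiv_fix_apply_ne`), so `s = t ∘ e` for a
  field isomorphism `e : K ≃ K'` carrying `Φ` to `Φ'` (`Φ' = {u | u ∘ e ∈ Φ}`).
* §2 **`CMAlgebra.isSeparatingFamily_iff`** — `IsSeparatingFamily Φ ⟺ (every Φ_i primitive) ∧ (Φ_j = Φ_i ∘ e for a
  field isomorphism e : K_i ≃ K_j only if i = j)`; `isSeparatingFamily_of_isPrimitive`.
* §3 On abelian varieties, for realisations `(A_i, ι_i, θ_i)` of the `(K_i; Φ_i)` on `H¹`: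
  `isIsogenous_of_forall_mem_iff_comp` — realisations of CM-EQUIVALENT types are ISOGENOUS (transport of structure
  `IsCMTypeRealisation.transport` + Shimura §6.1 Corollary `Shimura1998_Thm2_Cor_holds`, unconditional in the tree);
  **`CMAlgebra.isSeparatingFamily_of_isSimple_of_pairwise_not_isIsogenous`** — SIMPLE, PAIRWISE NON-ISOGENOUS
  realisations carry a separating family (Shimura §8.2 Prop. 26 `isSimple_iff_isPrimitive` + §1); and
  `IsSeparatingFamily.isSimple` (each `A_i` is simple).

## References

* [Gordon1999HodgeAVSurvey] B. B. Gordon, *A survey of the Hodge conjecture for abelian varieties*, 7.4–7.5.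
* [Shimura1998] G. Shimura, *Abelian Varieties with Complex Multiplication and Modular Functions*, §6.1 Corollary of
  Theorem 2 (p. 41), §8.2 Proposition 26 (pp. 61–63).
* [Kubota1965] T. Kubota, *On the field extension by complex multiplication*, Trans. AMS 118 (1965), §2.
* [Lang2002] S. Lang, *Algebra*, GTM 211, Ch. V §2, Ch. VIII §1 (extension of embeddings; fixed fields).
-/

noncomputable section

open CategoryTheory NumberField Cardinal

namespace Literature.AlgebraicGeometry.Pohlmann1968

open Literature.NumberTheory.ComplexMultiplication
open Literature.AlgebraicGeometry.Motives (AbelianVariety CMType)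
open Literature.AlgebraicGeometry.HodgeTheory (complexBetti)
open Literature.AlgebraicGeometry.ComplexMultiplication
open Literature.FieldTheory.AlgClosed

/-! ## §1 Embeddings with the same pattern for two primitive types differ by a field isomorphism -/

section Galois

variable {K K' : Type} [Field K] [NumberField K] [Field K'] [NumberField K']

/-- A number field is countable (it is `ℚ^n` as a set). [folklore] -/
private theorem countable_numberField : Countable K :=
  Countable.of_equiv _ (Module.finBasis ℚ K).equivFun.toEquiv.symm

/-- The image `t(K') ⊆ ℂ` of a number field is a countable subfield. [folklore] -/
private theorem cardinalMk_fieldRange_le_aleph0 (t : K' →+* ℂ) : #t.fieldRange ≤ ℵ₀ := by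
  haveI := countable_numberField (K := K')
  haveI : Countable t.fieldRange := (Set.countable_range t).to_subtype
  exact Cardinal.mk_le_aleph0

omit [NumberField K] in
/-- The `Aut(ℂ)`-action on `Hom(K, ℂ)` is composition. [folklore] -/
private theorem smul_eq_comp (g : ℂ ≃+* ℂ) (j : K →+* ℂ) : g • j = (g : ℂ →+* ℂ).comp j := by
  rw [ringEquiv_smul_def, RingEquiv.toRingHom_eq_coe]

/-- **Same pattern ⟹ `s(K) ⊆ t(K')`, for `Φ` primitive.**  If `τ ∘ s ∈ Φ ⟺ τ ∘ t ∈ Φ'` for every `τ ∈ Aut(ℂ)` and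
`Φ ⊆ Hom(K, ℂ)` is primitive, then every automorphism of `ℂ` fixing `t(K')` pointwise fixes the pattern of `s`, hence
fixes `s` (Shimura §8.2 Prop. 26 in Kubota's separation form, `isPrimitive_iff_forall_eq`); as the fixed field of
`Aut(ℂ/t(K'))` is `t(K')` (Lang, *Algebra* VIII §1; tree `Complex.exists_ringEquiv_fix_apply_ne`), `s(K) ⊆ t(K')`.
[cite: Shimura1998, §8.2 Proposition 26 (pp. 61–63)] [cite: Lang2002, Ch. VIII §1] -/
theorem fieldRange_le_of_isPrimitive_of_forall_comp_mem_iff {Φ : Set (K →+* ℂ)} {Φ' : Set (K' →+* ℂ)}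
    {s₀ s : K →+* ℂ} (hΦ : IsPrimitive (ℂ ≃+* ℂ) Φ s₀) {t : K' →+* ℂ}
    (hpat : ∀ τ : ℂ ≃+* ℂ, (τ : ℂ →+* ℂ).comp s ∈ Φ ↔ (τ : ℂ →+* ℂ).comp t ∈ Φ') :
    s.fieldRange ≤ t.fieldRange := by
  haveI := isPretransitive_ringEquiv_complex (K := K)
  rintro _ ⟨x, rfl⟩
  by_contra hx
  obtain ⟨σ, hfix, hne⟩ := Complex.exists_ringEquiv_fix_apply_ne t.fieldRange (cardinalMk_fieldRange_le_aleph0 t) hx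
  -- `σ` fixes `t`
  have hσt : σ • t = t := RingHom.ext fun y => by
    rw [ringEquiv_smul_apply]
    exact hfix (t y) ⟨y, rfl⟩
  -- hence `σ • s` and `s` have the same `Φ`-pattern, so `σ • s = s` by primitivity
  have hσs : σ • s = s := by
    refine (isPrimitive_iff_forall_eq (G := ℂ ≃+* ℂ) Φ s₀).1 hΦ (σ • s) s fun g => ?_
    rw [← mul_smul, smul_eq_comp, smul_eq_comp, hpat, hpat, ← smul_eq_comp, ← smul_eq_comp, mul_smul, hσt]
  exact hne (by rw [← ringEquiv_smul_apply σ s x, hσs])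

/-- **Same pattern for two PRIMITIVE types ⟹ `s(K) = t(K')`.** [cite: Shimura1998, §8.2 Proposition 26 (pp. 61–63)]
[cite: Lang2002, Ch. VIII §1] -/
theorem fieldRange_eq_of_isPrimitive_of_forall_comp_mem_iff {Φ : Set (K →+* ℂ)} {Φ' : Set (K' →+* ℂ)}
    {s₀ s : K →+* ℂ} {t₀ t : K' →+* ℂ} (hΦ : IsPrimitive (ℂ ≃+* ℂ) Φ s₀) (hΦ' : IsPrimitive (ℂ ≃+* ℂ) Φ' t₀)
    (hpat : ∀ τ : ℂ ≃+* ℂ, (τ : ℂ →+* ℂ).comp s ∈ Φ ↔ (τ : ℂ →+* ℂ).comp t ∈ Φ') :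
    s.fieldRange = t.fieldRange :=
  le_antisymm (fieldRange_le_of_isPrimitive_of_forall_comp_mem_iff hΦ hpat)
    (fieldRange_le_of_isPrimitive_of_forall_comp_mem_iff hΦ' fun τ => (hpat τ).symm)

omit [NumberField K] [NumberField K'] in
/-- **Two embeddings of number fields with the same image differ by a field isomorphism**: if `s(K) = t(K')` inside
`ℂ` then `s = t ∘ e` for some `e : K ≃ K'` (private helper). [folklore] -/
private theorem exists_ringEquiv_comp_eq_of_fieldRange_eq {s : K →+* ℂ} {t : K' →+* ℂ}
    (h : s.fieldRange = t.fieldRange) : ∃ e : K ≃+* K', t.comp e.toRingHom = s := by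
  let f : K →+* K' :=
    t.rangeRestrictFieldEquiv.symm.toRingHom.comp ((Subfield.inclusion h.le).comp s.rangeRestrictField)
  have hf : ∀ x, t (f x) = s x := fun x => by
    have h1 : ((t.rangeRestrictFieldEquiv (t.rangeRestrictFieldEquiv.symm
        (Subfield.inclusion h.le (s.rangeRestrictField x)))) : ℂ) =
        (Subfield.inclusion h.le (s.rangeRestrictField x) : ℂ) := by
      rw [RingEquiv.apply_symm_apply]
    exact h1
  have hsurj : Function.Surjective f := fun y => by
    have hy : t y ∈ s.fieldRange := h ▸ ⟨y, rfl⟩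
    obtain ⟨x, hx⟩ := hy
    exact ⟨x, t.injective (by rw [hf x]; exact hx)⟩
  refine ⟨RingEquiv.ofBijective f ⟨f.injective, hsurj⟩, RingHom.ext fun x => ?_⟩
  exact hf x

/-- **Embeddings with the same pattern for two PRIMITIVE types differ by a field isomorphism carrying one type to the
other.**  Let `Φ ⊆ Hom(K, ℂ)`, `Φ' ⊆ Hom(K', ℂ)` be primitive and `s : K → ℂ`, `t : K' → ℂ` with
`τ ∘ s ∈ Φ ⟺ τ ∘ t ∈ Φ'` for all `τ ∈ Aut(ℂ)`.  Then there is `e : K ≃ K'` with `t ∘ e = s` and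
`Φ' = {u | u ∘ e ∈ Φ}` (every `u : K' → ℂ` is `τ ∘ t`, `Aut(ℂ)` being transitive on `Hom(K', ℂ)`).  For CM types:
`(K; Φ)` and `(K'; Φ')` are the SAME CM type up to the isomorphism `e` — the situation excluded between distinct
members by Gordon's hypothesis «`A_i` simple and nonisogenous» (Def. 7.4).
[cite: Shimura1998, §8.2 Proposition 26 (pp. 61–63)] [cite: Gordon1999HodgeAVSurvey, 7.4] -/
theorem exists_ringEquiv_of_isPrimitive_of_forall_comp_mem_iff {Φ : Set (K →+* ℂ)} {Φ' : Set (K' →+* ℂ)}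
    {s₀ s : K →+* ℂ} {t₀ t : K' →+* ℂ} (hΦ : IsPrimitive (ℂ ≃+* ℂ) Φ s₀) (hΦ' : IsPrimitive (ℂ ≃+* ℂ) Φ' t₀)
    (hpat : ∀ τ : ℂ ≃+* ℂ, (τ : ℂ →+* ℂ).comp s ∈ Φ ↔ (τ : ℂ →+* ℂ).comp t ∈ Φ') :
    ∃ e : K ≃+* K', t.comp e.toRingHom = s ∧ ∀ u : K' →+* ℂ, u ∈ Φ' ↔ u.comp e.toRingHom ∈ Φ := by
  haveI := isPretransitive_ringEquiv_complex (K := K')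
  obtain ⟨e, he⟩ := exists_ringEquiv_comp_eq_of_fieldRange_eq
    (fieldRange_eq_of_isPrimitive_of_forall_comp_mem_iff hΦ hΦ' hpat)
  refine ⟨e, he, fun u => ?_⟩
  obtain ⟨g, rfl⟩ := MulAction.exists_smul_eq (ℂ ≃+* ℂ) t u
  rw [smul_eq_comp, RingHom.comp_assoc, he]
  exact (hpat g).symm

end Galois

/-! ## §2 Separating ⟺ primitive members, pairwise CM-inequivalent -/

namespace CMAlgebra

variable {I : Type} {K : I → Type} [∀ i, Field (K i)] [∀ i, NumberField (K i)]

/-- **Primitive, pairwise CM-inequivalent types form a separating family** (converse of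
`IsSeparatingFamily.isPrimitive` / `.eq_of_forall_mem_iff_comp_mem`): two points `(i, s)`, `(j, t)` of `⊔_i Hom(K_i, ℂ)`
with the same `Σ`-pattern give a field isomorphism `e : K_i ≃ K_j` with `Φ_j = Φ_i ∘ e` (§1), so `i = j`, and then
`s = t` by the primitivity of `Φ_i`. [cite: Kubota1965, §2 (p. 115)] [cite: Gordon1999HodgeAVSurvey, 7.4] -/
theorem isSeparatingFamily_of_isPrimitive {Φ : ∀ i, CMType (K i)}
    (hprim : ∀ (i : I) (s₀ : K i →+* ℂ), IsPrimitive (ℂ ≃+* ℂ) (Φ i).1 s₀)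
    (hne : ∀ (i j : I) (e : K i ≃+* K j), (∀ u : K j →+* ℂ, u ∈ (Φ j).1 ↔ u.comp e.toRingHom ∈ (Φ i).1) → i = j) :
    IsSeparatingFamily Φ := by
  rintro ⟨i, s⟩ ⟨j, t⟩ hpat
  obtain ⟨e, -, hΦ⟩ := exists_ringEquiv_of_isPrimitive_of_forall_comp_mem_iff (hprim i s) (hprim j t) hpat
  obtain rfl := hne i j e hΦ
  obtain rfl : s = t := (isPrimitive_ringEquiv_complex_iff (Φ i) s).1 (hprim i s) s t hpat
  rfl

/-- **Separating ⟺ every member primitive and no two members CM-equivalent along a field isomorphism** — Kubota's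
primitivity of the CM type `Σ` of `∏_i K_i` is exactly Gordon's standing hypothesis «`A_i` simple (Shimura §8.2
Prop. 26: ⟺ `Φ_i` primitive) and pairwise nonisogenous (§6.1 Cor.: realisations of equivalent types are
isogenous)» of Def. 7.4 / Thm. 7.5. [cite: Gordon1999HodgeAVSurvey, 7.4] [cite: Kubota1965, §2 (p. 115)] -/
theorem isSeparatingFamily_iff (Φ : ∀ i, CMType (K i)) :
    IsSeparatingFamily Φ ↔
      (∀ (i : I) (s₀ : K i →+* ℂ), IsPrimitive (ℂ ≃+* ℂ) (Φ i).1 s₀) ∧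
        ∀ (i j : I) (e : K i ≃+* K j), (∀ u : K j →+* ℂ, u ∈ (Φ j).1 ↔ u.comp e.toRingHom ∈ (Φ i).1) → i = j :=
  ⟨fun h => ⟨fun i s₀ => h.isPrimitive i s₀, fun _ _ e he => h.eq_of_forall_mem_iff_comp_mem e he⟩,
    fun h => isSeparatingFamily_of_isPrimitive h.1 h.2⟩

end CMAlgebra

/-! ## §3 On abelian varieties: simple, pairwise non-isogenous realisations -/

section Realisations

/-- **Realisations of CM-EQUIVALENT types are isogenous.**  If `(A, ι, θ)` realises `(K; Φ)` on `H¹`, `(A', ι', θ')`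
realises `(K'; Φ')`, and `Φ' = {u | u ∘ e ∈ Φ}` for a field isomorphism `e : K ≃ K'`, then `A ∼ A'`: along `e`,
`(A, ι ∘ 𝓞(e⁻¹), θ ∘ e⁻¹)` realises `(K'; Φ')` (transport of structure), and two realisations of one CM type are
isogenous (Shimura §6.1 Corollary of Theorem 2, tree theorem `Shimura1998_Thm2_Cor_holds`).
[cite: Shimura1998, §6.1 Corollary of Theorem 2 (p. 41)] -/
theorem isIsogenous_of_forall_mem_iff_comp {K K' : Type} [Field K] [NumberField K] [IsCMField K] [Field K']
    [NumberField K'] [IsCMField K'] {Φ : CMType K} {Φ' : CMType K'} (e : K ≃+* K')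
    (he : ∀ u : K' →+* ℂ, u ∈ Φ'.1 ↔ u.comp e.toRingHom ∈ Φ.1)
    {A : AbelianVariety ℂ} {ι : 𝓞 K →+* End A} {θ : K →+* Module.End ℂ (complexBetti A.X 1)}
    {A' : AbelianVariety ℂ} {ι' : 𝓞 K' →+* End A'} {θ' : K' →+* Module.End ℂ (complexBetti A'.X 1)}
    (hA : IsCMTypeRealisation Φ A ι θ) (hA' : IsCMTypeRealisation Φ' A' ι' θ') :
    AbelianVariety.IsIsogenous A A' := by
  have hT := hA.transport e
  have hΦ' : Literature.NumberTheory.Automorphic.PicardCM.CMCode.cmTypeMap e Φ = Φ' :=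
    Subtype.ext (Set.ext fun u =>
      (Literature.NumberTheory.Automorphic.PicardCM.CMCode.mem_cmTypeMap_iff e Φ u).trans (he u).symm)
  rw [hΦ'] at hT
  obtain ⟨g, hg, -⟩ := Shimura1998_Thm2_Cor_holds K' Φ' A _ _ A' ι' θ' hT hA'
  exact ⟨g, hg⟩

variable {I : Type} {K : I → Type} [∀ i, Field (K i)] [∀ i, NumberField (K i)] [∀ i, IsCMField (K i)]
  {Φ : ∀ i, CMType (K i)} {A : I → AbelianVariety ℂ} {ι : ∀ i, 𝓞 (K i) →+* End (A i)}
  {θ : ∀ i, K i →+* Module.End ℂ (complexBetti (A i).X 1)}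

/-- **Simple, pairwise non-isogenous realisations carry a SEPARATING family of CM types** — Gordon's hypothesis
«`A ~ ∏_i A_i^{m_i}` with the `A_i` simple and nonisogenous» (Def. 7.4) implies Kubota separation for
`Σ = ⊔_i Φ_i`: each `Φ_i` is primitive (Shimura §8.2 Prop. 26, `isSimple_iff_isPrimitive`) and CM-equivalent members
would have isogenous realisations (`isIsogenous_of_forall_mem_iff_comp`).
[cite: Gordon1999HodgeAVSurvey, 7.4] [cite: Shimura1998, §8.2 Proposition 26 and §6.1 Corollary] -/
theorem CMAlgebra.isSeparatingFamily_of_isSimple_of_pairwise_not_isIsogenous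
    (hA : ∀ i, IsCMTypeRealisation (Φ i) (A i) (ι i) (θ i)) (hs : ∀ i, (A i).IsSimple)
    (hniso : ∀ i j, i ≠ j → ¬ AbelianVariety.IsIsogenous (A i) (A j)) : CMAlgebra.IsSeparatingFamily Φ :=
  CMAlgebra.isSeparatingFamily_of_isPrimitive (fun i s₀ => (isSimple_iff_isPrimitive (hA i) s₀).1 (hs i))
    fun i j e he => by_contra fun hij => hniso i j hij (isIsogenous_of_forall_mem_iff_comp e he (hA i) (hA j))

omit [∀ i, IsCMField (K i)] in
/-- **Each member of a separating family is realised by SIMPLE abelian varieties** (`Φ_i` primitive ⟹ `A_i` simple,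
Shimura §8.2 Prop. 26). [cite: Shimura1998, §8.2 Proposition 26 (p. 63)] -/
theorem CMAlgebra.IsSeparatingFamily.isSimple (hΦ : CMAlgebra.IsSeparatingFamily Φ)
    (hA : ∀ i, IsCMTypeRealisation (Φ i) (A i) (ι i) (θ i)) (i : I) : (A i).IsSimple := by
  obtain ⟨s₀⟩ : Nonempty (K i →+* ℂ) := inferInstance
  exact (isSimple_iff_isPrimitive (hA i) s₀).2 (hΦ.isPrimitive i s₀)

end Realisations

end Literature.AlgebraicGeometry.Pohlmann1968

end
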